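import Summits.PneNP.PneNP.Theorems.ConvexRankGatesCaptureCosetMeetToJoinAbelian
import HarnessLib

/-!
# Crux `Capture` (stmt-PneNP-2659), line `csp-spine-meet-to-join` — the MEET-TO-JOIN DUAL interface
# (`meetToJoinDual_unsat_iff`, `meetToJoinDual_cktSize`)

The abstract form of every PERM construction of the line (abelian coset gates p77657/p80200, ring span
programs p110419, two-step gates p113968) and the exact target of its two open stubs
(`stub_pGroupResidualCapture`, `stub_nonNilpotentCosetCapture`; dossier
`Cruxes/Capture/Lines/csp-spine-meet-to-join-dead-c4.md` §4).

Data: constraints `C j ⊆ P` (`j : Fin m`; think `P = Gⁿ`, `C j` a cylinder coset), a class `Adm` of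
"admissible" sets (think: cosets) containing the `C j` and the points and closed under nonempty
intersection with a `C j`, a map `N : Set P → Subgroup D` and a set `Z ⊆ D` of "contradictions" with

* MEET-TO-JOIN: `N (X ∩ C j) = N X ⊔ N (C j)` whenever `X` is admissible and `X ∩ C j ≠ ∅`;
* DISJOINTNESS FIRES: `X` admissible, nonempty, `X ∩ C j = ∅` ⟹ some `z ∈ Z` lies in `N X ⊔ N (C j)`
  (and an empty constraint carries a contradiction in its own `N`);
* POINTS ARE CONSISTENT: no `z ∈ Z` lies in `N {a}`.

Then (`meetToJoinDual_unsat_iff`) the selected constraints have NO common point iff some `z ∈ Z` lies in the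
join of the selected `N (C j)` — soundness is "evaluate at a common point", completeness is "intersect one
constraint at a time"; and (`meetToJoinDual_cktSize`) when `D = Perm (Fin d)`, `d ≤ S`, the unsatisfiability
function of the selection is an OR of `|Z|` PERM gates: a `permBasis S`-circuit with `≤ 2|Z| + 1` gates (one PERM
gate per contradiction, generators = all elements of `N (C j)` wired to input `j`; OR-fold `ab_cktSize_exists`).
For abelian `G` the dual is Pontryagin's (`N (a+K) = {(χ, χ a) : χ ∈ K^⊥}`); for nonabelian `G` a dual of
polynomial degree is the open "nonabelian meet-to-join" problem. Lead c4, 2026-08-16. [folklore]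
-/

namespace Summit.PneNP.PneNP.Cruxes.Capture.CspSpineMeetToJoin

set_option linter.dupNamespace false -- `Summit.PneNP.PneNP.…`: summit = sub-problem (D-0017)

open Literature.Computability.Complexity

/-- **Meet-to-join duals decide unsatisfiability by one membership per contradiction** (registered sub-goal
`meetToJoinDual_unsat_iff`). With the three laws of the module docstring, the selected constraints `C j`
(`v j = true`) have no common point iff some contradiction `z ∈ Z` lies in `⨆_{v j} N (C j)`. [folklore] -/
theorem meetToJoinDual_unsat_iff : ∀ (P D : Type) [Group D] [Nonempty P] (m : ℕ) (C : Fin m → Set P)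
    (Adm : Set P → Prop) (N : Set P → Subgroup D) (Z : Set D),
    (∀ j, Adm (C j)) → (∀ a : P, Adm {a}) →
    (∀ (X : Set P) (j : Fin m), Adm X → (X ∩ C j).Nonempty → Adm (X ∩ C j)) →
    (∀ (X : Set P) (j : Fin m), Adm X → (X ∩ C j).Nonempty → N (X ∩ C j) = N X ⊔ N (C j)) →
    (∀ (X : Set P) (j : Fin m), Adm X → X.Nonempty → X ∩ C j = ∅ → ∃ z ∈ Z, z ∈ N X ⊔ N (C j)) →
    (∀ j, C j = ∅ → ∃ z ∈ Z, z ∈ N (C j)) →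
    (∀ (a : P), ∀ z ∈ Z, z ∉ N {a}) →
    ∀ v : Fin m → Bool,
      (¬ ∃ a : P, ∀ j, v j = true → a ∈ C j) ↔ ∃ z ∈ Z, z ∈ ⨆ j ∈ {j | v j = true}, N (C j) := by
  intro P D _ _ m C Adm N Z hC hpt hinter hmeet hdisj h0 hZ v
  classical
  -- the big join of the selected constraints
  set J : Subgroup D := ⨆ j ∈ {j | v j = true}, N (C j) with hJ
  have hle : ∀ j, v j = true → N (C j) ≤ J := fun j hj => by
    rw [hJ]
    exact le_iSup₂_of_le j hj le_rfl
  constructor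
  · -- completeness: intersect the selected constraints one at a time
    intro hunsat
    -- partial intersections along a list of selected indices
    let XS : List (Fin m) → Set P := fun l => {a | ∀ j ∈ l, a ∈ C j}
    have hXS_cons : ∀ (j : Fin m) (l : List (Fin m)), XS (j :: l) = XS l ∩ C j := fun j l => by
      ext a
      simp only [XS, List.mem_cons, forall_eq_or_imp, Set.mem_setOf_eq, Set.mem_inter_iff]
      tauto
    have hXS_single : ∀ j : Fin m, XS [j] = C j := fun j => by
      ext a
      simp [XS]
    -- claim: for a nonempty list of selected indices, either a contradiction is in `J`, or the partial
    -- intersection is admissible, nonempty and its `N` lies below `J`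
    have claim : ∀ l : List (Fin m), l ≠ [] → (∀ j ∈ l, v j = true) →
        (∃ z ∈ Z, z ∈ J) ∨ (Adm (XS l) ∧ (XS l).Nonempty ∧ N (XS l) ≤ J) := by
      intro l
      induction l with
      | nil => intro h; exact absurd rfl h
      | cons j l ih =>
        intro _ hsel
        have hj : v j = true := hsel j List.mem_cons_self
        by_cases hl : l = []
        · subst hl
          rw [hXS_single]
          by_cases hCj : C j = ∅
          · obtain ⟨z, hz, hzN⟩ := h0 j hCj
            exact Or.inl ⟨z, hz, hle j hj hzN⟩
          · exact Or.inr ⟨hC j, Set.nonempty_iff_ne_empty.2 hCj, hle j hj⟩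
        · rcases ih hl (fun j' hj' => hsel j' (List.mem_cons_of_mem j hj')) with hdone | ⟨hadm, hne, hNle⟩
          · exact Or.inl hdone
          · rw [hXS_cons]
            by_cases hcap : XS l ∩ C j = ∅
            · obtain ⟨z, hz, hzN⟩ := hdisj (XS l) j hadm hne hcap
              exact Or.inl ⟨z, hz, (sup_le hNle (hle j hj)) hzN⟩
            · have hne' : (XS l ∩ C j).Nonempty := Set.nonempty_iff_ne_empty.2 hcap
              refine Or.inr ⟨hinter _ j hadm hne', hne', ?_⟩
              rw [hmeet _ j hadm hne']
              exact sup_le hNle (hle j hj)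
    -- apply the claim to the list of all selected indices
    set l : List (Fin m) := (Finset.univ.filter fun j => v j = true).toList with hl
    have hmem : ∀ j, j ∈ l ↔ v j = true := fun j => by
      rw [hl, Finset.mem_toList, Finset.mem_filter]
      simp
    by_cases hnil : l = []
    · -- nothing selected: every point is a common point
      exfalso
      refine hunsat ⟨Classical.arbitrary P, fun j hj => ?_⟩
      have : j ∈ l := (hmem j).2 hj
      rw [hnil] at this
      exact absurd this List.not_mem_nil
    · rcases claim l hnil (fun j hj => (hmem j).1 hj) with hdone | ⟨-, ⟨a, ha⟩, -⟩
      · exact hdone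
      · exfalso
        exact hunsat ⟨a, fun j hj => ha j ((hmem j).2 hj)⟩
  · -- soundness: evaluate at a common point
    rintro ⟨z, hz, hzJ⟩ ⟨a, ha⟩
    have hJa : J ≤ N {a} := by
      rw [hJ]
      refine iSup₂_le fun j hj => ?_
      have hcap : ({a} : Set P) ∩ C j = {a} :=
        Set.inter_eq_left.2 (Set.singleton_subset_iff.2 (ha j hj))
      have h := hmeet {a} j (hpt a) (by rw [hcap]; exact Set.singleton_nonempty a)
      rw [hcap] at h
      calc N (C j) ≤ N {a} ⊔ N (C j) := le_sup_right
        _ = N {a} := h.symm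
    exact hZ a z hz (hJa hzJ)

/-- **Meet-to-join duals of permutation degree `d ≤ S` are an OR of PERM gates** (registered sub-goal
`meetToJoinDual_cktSize`): under the laws of `meetToJoinDual_unsat_iff` with `D = Perm (Fin d)` and a finite
set `Z` of contradictions, the function "the selected constraints have no common point" has a
`permBasis S`-circuit with `≤ 2|Z| + 1` gates — one PERM gate per `z ∈ Z` (generators: all elements of
`N (C j)`, each wired to input `j`), OR-folded. [folklore] -/
theorem meetToJoinDual_cktSize : ∀ (P : Type) [Nonempty P] (d m : ℕ) (C : Fin m → Set P)
    (Adm : Set P → Prop) (N : Set P → Subgroup (Equiv.Perm (Fin d))) (Z : Finset (Equiv.Perm (Fin d))),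
    (∀ j, Adm (C j)) → (∀ a : P, Adm {a}) →
    (∀ (X : Set P) (j : Fin m), Adm X → (X ∩ C j).Nonempty → Adm (X ∩ C j)) →
    (∀ (X : Set P) (j : Fin m), Adm X → (X ∩ C j).Nonempty → N (X ∩ C j) = N X ⊔ N (C j)) →
    (∀ (X : Set P) (j : Fin m), Adm X → X.Nonempty → X ∩ C j = ∅ → ∃ z ∈ Z, z ∈ N X ⊔ N (C j)) →
    (∀ j, C j = ∅ → ∃ z ∈ Z, z ∈ N (C j)) →
    (∀ (a : P), ∀ z ∈ Z, z ∉ N {a}) →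
    ∀ (f : (Fin m → Bool) → Bool),
      (∀ v, f v = true ↔ ¬ ∃ a : P, ∀ j, v j = true → a ∈ C j) →
      ∀ S : ℕ, d ≤ S → CktSize (permBasis S) (fun v (_ : Unit) => f v) (2 * Z.card + 1) := by
  intro P _ d m C Adm N Z hC hpt hinter hmeet hdisj h0 hZ f hf S hS
  classical
  -- slots: every element of every `N (C j)`, owned by `j`
  let Row : Type := Σ j : Fin m, N (C j)
  let n : ℕ := Fintype.card Row
  let eq : Row ≃ Fin n := Fintype.equivFin Row
  let wire : Fin n → Fin m := fun i => (eq.symm i).1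
  let ρ : Fin n → Equiv.Perm (Fin d) := fun i => ((eq.symm i).2 : Equiv.Perm (Fin d))
  -- one PERM gate per contradiction `z`
  let Pz : Equiv.Perm (Fin d) → (Fin n → Bool) → Bool := fun z u =>
    decide (z ∈ Subgroup.closure (ρ '' {i | u i = true}))
  have hPB : ∀ z, (⟨n, Pz z⟩ : GateFn) ∈ permBasis S := fun z =>
    Or.inr ⟨d, hS, ρ, z, fun u => decide_eq_true_iff⟩
  have hor : GateFn.or 2 ∈ permBasis S := by simp [permBasis, monConst]
  have hfalse : GateFn.const false ∈ permBasis S := by simp [permBasis, monConst]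
  -- semantics: the generated subgroup on the selection `v` is the join of the selected `N (C j)`
  have hsem : ∀ (z : Equiv.Perm (Fin d)) (v : Fin m → Bool), Pz z (fun i => v (wire i)) = true ↔
      z ∈ ⨆ j ∈ {j | v j = true}, N (C j) := by
    intro z v
    have hset : ρ '' {i | v (wire i) = true} = ⋃ j ∈ {j | v j = true}, (N (C j) : Set (Equiv.Perm (Fin d))) := by
      ext y
      simp only [Set.mem_image, Set.mem_setOf_eq, Set.mem_iUnion, exists_prop, SetLike.mem_coe]
      constructor
      · rintro ⟨i, hi, rfl⟩
        exact ⟨(eq.symm i).1, hi, (eq.symm i).2.2⟩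
      · rintro ⟨j, hj, hy⟩
        refine ⟨eq ⟨j, y, hy⟩, ?_, ?_⟩
        · show v (eq.symm (eq ⟨j, y, hy⟩)).1 = true
          rw [Equiv.symm_apply_apply]; exact hj
        · show ((eq.symm (eq ⟨j, y, hy⟩)).2 : Equiv.Perm (Fin d)) = y
          rw [Equiv.symm_apply_apply]
    simp only [Pz, decide_eq_true_eq]
    rw [hset]
    simp only [Subgroup.closure_iUnion, Subgroup.closure_eq]
  -- OR over the contradictions
  have hsize := ab_cktSize_exists hor hfalse (fun z (v : Fin m → Bool) => Pz z (fun i => v (wire i))) Z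
    (fun z _ => CktSize.gate (B := permBasis S) ⟨n, Pz z⟩ (hPB z) wire)
  refine hsize.congr fun v _ => ?_
  rw [Bool.eq_iff_iff, hf v, meetToJoinDual_unsat_iff P (Equiv.Perm (Fin d)) m C Adm N (↑Z) hC hpt hinter
    hmeet (fun X j hX hne hcap => hdisj X j hX hne hcap) (fun j hj => h0 j hj) (fun a z hz => hZ a z hz) v]
  simp only [Finset.mem_coe, decide_eq_true_eq, hsem]

end Summit.PneNP.PneNP.Cruxes.Capture.CspSpineMeetToJoin
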